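import Summits.BirchSwinnertonDyer.Rank1Residual.X10.ResidualSelmerLocalRamificationInt
import Summits.BirchSwinnertonDyer.Rank1Residual.X10.ResidualSelmerParityRecordsB
import Summits.BirchSwinnertonDyer.Rank1Residual.X11b.KummerLocalIndex
import Literature.NumberTheory.EllipticCurves.Rank1Residual.Typed.X5DescentSelmer
import HarnessLib

/-!
# N2 (X10b @ 3): THE GENERATOR TEST (G) FOR `118810j1` IN THE KERNEL — `S⁰(118810j1) = 0`.
# §A (PART XII of the `E[p]` instance of the N2 parity law, TOOL): the DECIDABLE READING of
# "P reduces to the node" for a rational point on an integer model; §B (RECORD): the cell `118810j1`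
# (cell `b2b-bsdres`, unit `b2b-bsdres-x10` = N2 class lead, GEN 32; theorems only, no definition;
# §A has no named fact, §B displays ONE named-fact hypothesis `poitouTate_selmerStructure_duality ℚ`
# and the census `#Sel₃ = 3`; nothing booked; steps (b)–(d) of the G-LOCAL chain of X10-AUDIT §38.5d)

## §A — What

HONEST FRAMING (run/shared/lean/b2b/bsd-rank1-residual/, verbatim in every file): the goal of the
cell is to DELETE the COMBINATION-SHAPED residual classes of the Birch–Swinnerton-Dyer formula for
ALL analytic-rank `≤ 1` elliptic curves over `ℚ` — "full BSD formula for every rank `≤ 1` curve in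
class `C`" assembled STRICTLY from published theorems — so that the rank-`≤ 1` remainder becomes
exactly the CONSTRUCTION-SHAPED classes, which are TYPED (missing-input `Prop`s), NOT attempted.
This is not "finishing BSD". Class X10b (= N2) keeps its label CONSTRUCTION-SHAPED (NEEDS `X_A3`,
referee R82.3 / RESIDUAL-MAP §I N2); this file is a TOOL; no mark / label / tier / count moves.

For an integer equation `E₀`, a prime `q` with place `v`, integers `r, t` and a point
`(x, y) ∈ E₀(ℚ) ⊆ E₀(ℚ_v)`: if the translate `T • E₀`, `T = (u, r, s, t) = (1, r, 0, t)` (moving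
`(r, t)` to the origin) has `q ∣ a₃'`, `q ∣ a₄'` (so `(r̄, t̄)` is the singular point of `E₀ mod q` once
it lies on the curve) and `x − r = m/n`, `y − t = m'/n'` with `q ∣ m, m'`, `q ∤ n, n'` (`(x, y) ≡ (r, t)
mod q`), then `(x, y)` has SINGULAR reduction on `E₀ ⊗ ℤ_v`:
**`not_hasNonsingularReduction_of_reduces_to_node`** (the tree's
`LocalIndex.hasNonsingularReduction_pointEquiv_iff` along `T`, `LocalIndex.not_hasNonsingularReduction_some`,
and the valuation of a rational number at `v`). Every hypothesis on `E₀, r, t, m, n` is `decide`-able;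
with PART XI this makes "`κ_v(P)` is RAMIFIED" a kernel certificate (record `118810j1`: `q = 5`,
`(r, t) = (3, 1)`, `P = (187/9, 3262/27)`, `x − 3 = 160/9`, `y − 1 = 3235/27`).

References: [SilvermanAEC2009] VII.1 Prop. 1.3(b), VII.2; HOME/X10-AUDIT.md §38.5d.
-/

set_option autoImplicit false

noncomputable section

open scoped Classical NNReal

open Function NumberField IsDedekindDomain Field WeierstrassCurve IsLocalRing
  Literature.NumberTheory.EllipticCurves Literature.NumberTheory.GaloisRepresentations
  IsDedekindDomain.HeightOneSpectrum Rat.HeightOneSpectrum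

namespace Summit.BirchSwinnertonDyer.Rank1Residual.X10.ResidualSelmerLocalRamificationRat

variable (v : HeightOneSpectrum (𝓞 ℚ))

/-! ### §1. Rational numbers in `𝔪_v` -/

/-- `x ∈ ℤ_v` is in `𝔪_v` iff `|x|_v < 1`. [folklore] -/
theorem mem_maximalIdeal_iff_lt_one (z : v.adicCompletionIntegers ℚ) :
    z ∈ maximalIdeal (v.adicCompletionIntegers ℚ) ↔ Valued.v (z : v.adicCompletion ℚ) < 1 := by
  rw [IsLocalRing.mem_maximalIdeal, mem_nonunits_iff]
  exact Valuation.Integer.not_isUnit_iff_valuation_lt_one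

/-- `|m/n|_v < 1` for `p_v ∣ m`, `p_v ∤ n`. [folklore] -/
theorem valuation_div_lt_one {m : ℤ} {n : ℕ} (hm : (natGenerator v : ℤ) ∣ m)
    (hn : ¬ (natGenerator v : ℤ) ∣ n) : v.valuation ℚ ((m : ℚ) / n) < 1 := by
  rw [map_div₀, show ((n : ℚ)) = ((n : ℤ) : ℚ) by norm_cast, Rat.valuation_intCast_eq_one v hn, div_one]
  refine lt_of_le_of_lt (Rat.valuation_intCast_le v (e := 1) (by rwa [pow_one])) ?_
  rw [← WithZero.exp_zero]
  exact WithZero.exp_lt_exp.mpr (by norm_num)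

/-- **A rational number `m/n` with `p_v ∣ m`, `p_v ∤ n` lies in `𝔪_v`**: there is `a ∈ 𝔪_v ⊆ ℤ_v`
with `a = m/n` in `ℚ_v`. [folklore] -/
theorem exists_mem_maximalIdeal_eq_div {m : ℤ} {n : ℕ} (hm : (natGenerator v : ℤ) ∣ m)
    (hn : ¬ (natGenerator v : ℤ) ∣ n) :
    ∃ a : v.adicCompletionIntegers ℚ, a ∈ maximalIdeal (v.adicCompletionIntegers ℚ) ∧
      (a : v.adicCompletion ℚ) = algebraMap ℚ (v.adicCompletion ℚ) ((m : ℚ) / n) := by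
  have hlt : Valued.v (algebraMap ℚ (v.adicCompletion ℚ) ((m : ℚ) / n)) < 1 := by
    rw [show Valued.v (algebraMap ℚ (v.adicCompletion ℚ) ((m : ℚ) / n)) = v.valuation ℚ ((m : ℚ) / n) from
      valuedAdicCompletion_eq_valuation' v _]
    exact valuation_div_lt_one v hm hn
  exact ⟨⟨_, le_of_lt hlt⟩, (mem_maximalIdeal_iff_lt_one v _).mpr hlt, rfl⟩

/-- An integer divisible by `p_v` lies in `𝔪_v`. [folklore] -/
theorem intCast_mem_maximalIdeal {m : ℤ} (hm : (natGenerator v : ℤ) ∣ m) :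
    (m : v.adicCompletionIntegers ℚ) ∈ maximalIdeal (v.adicCompletionIntegers ℚ) := by
  rw [mem_maximalIdeal_iff_lt_one]
  have h1 : ((m : v.adicCompletionIntegers ℚ) : v.adicCompletion ℚ) =
      algebraMap ℚ (v.adicCompletion ℚ) (m : ℚ) := by
    rw [map_intCast]; exact SubringClass.coe_intCast _ m
  rw [h1, show Valued.v (algebraMap ℚ (v.adicCompletion ℚ) (m : ℚ)) = v.valuation ℚ (m : ℚ) from
    valuedAdicCompletion_eq_valuation' v _]
  have h2 : v.valuation ℚ ((m : ℚ) / (1 : ℕ)) < 1 :=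
    valuation_div_lt_one v hm (fun h => by
      have := Int.eq_one_of_dvd_one (Int.natCast_nonneg _) (by exact_mod_cast h)
      exact (prime_natGenerator v).ne_one (by exact_mod_cast this))
  simpa using h2

/-! ### §2. A rational point congruent to the node has singular reduction -/

/-- **The decidable reading of "`P` reduces to the node".** `E₀` an integer equation, `v` a finite
place of `ℚ`, `r t : ℤ` such that the translated equation `T • E₀`, `T = (1, r, 0, t)`, has
`p_v ∣ a₃'` and `p_v ∣ a₄'`; `(x, y) ∈ (E₀ ⊗ ℚ_v)(ℚ_v)` the image of a rational point with
`x − r = m/n`, `y − t = m'/n'`, `p_v ∣ m, m'`, `p_v ∤ n, n'`. Then `(x, y) ∉ E₀(ℚ_v)` for the model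
`E₀ ⊗ ℤ_v`. [cite: SilvermanAEC2009, VII.1 Prop. 1.3(b)] -/
theorem not_hasNonsingularReduction_of_reduces_to_node (E₀ : WeierstrassCurve ℤ) (r t : ℤ)
    (h3 : (natGenerator v : ℤ) ∣ E₀.a₃ + r * E₀.a₁ + 2 * t)
    (h4 : (natGenerator v : ℤ) ∣ E₀.a₄ + 2 * r * E₀.a₂ - t * E₀.a₁ + 3 * r ^ 2)
    {x y : ℚ} {m m' : ℤ} {n n' : ℕ} (hm : (natGenerator v : ℤ) ∣ m) (hn : ¬ (natGenerator v : ℤ) ∣ n)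
    (hm' : (natGenerator v : ℤ) ∣ m') (hn' : ¬ (natGenerator v : ℤ) ∣ n')
    (hx : x - r = (m : ℚ) / n) (hy : y - t = (m' : ℚ) / n')
    (h : ((E₀.map (Int.castRingHom (v.adicCompletionIntegers ℚ))).baseChange
        (v.adicCompletion ℚ)).toAffine.Nonsingular
      (algebraMap ℚ (v.adicCompletion ℚ) x) (algebraMap ℚ (v.adicCompletion ℚ) y)) :
    ¬ (E₀.map (Int.castRingHom (v.adicCompletionIntegers ℚ))).HasNonsingularReduction (.some _ _ h) := by
  obtain ⟨D, hD⟩ : ∃ D : VariableChange (v.adicCompletionIntegers ℚ),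
      D = ⟨1, (r : v.adicCompletionIntegers ℚ), 0, (t : v.adicCompletionIntegers ℚ)⟩ := ⟨_, rfl⟩
  -- move the question to `D • I`, the translate of the integer model
  rw [← LocalIndex.hasNonsingularReduction_pointEquiv_iff
    (E₀.map (Int.castRingHom (v.adicCompletionIntegers ℚ))) D]
  have hD3 : (D • E₀.map (Int.castRingHom (v.adicCompletionIntegers ℚ))).a₃ =
      ((E₀.a₃ + r * E₀.a₁ + 2 * t : ℤ) : v.adicCompletionIntegers ℚ) := by
    rw [variableChange_a₃, hD]
    simp only [map_a₁, map_a₃, eq_intCast, inv_one, Units.val_one, one_pow, one_mul]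
    push_cast; ring
  have hD4 : (D • E₀.map (Int.castRingHom (v.adicCompletionIntegers ℚ))).a₄ =
      ((E₀.a₄ + 2 * r * E₀.a₂ - t * E₀.a₁ + 3 * r ^ 2 : ℤ) : v.adicCompletionIntegers ℚ) := by
    rw [variableChange_a₄, hD]
    simp only [map_a₁, map_a₂, map_a₃, map_a₄, eq_intCast, inv_one, Units.val_one, one_pow, one_mul,
      zero_mul, mul_zero, sub_zero, add_zero]
    push_cast; ring
  -- the coordinates of `D • P`: `x − r` and `y − t`, both in `𝔪_v`
  obtain ⟨a, ha, hax⟩ := exists_mem_maximalIdeal_eq_div v hm hn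
  obtain ⟨b, hb, hby⟩ := exists_mem_maximalIdeal_eq_div v hm' hn'
  have hX : (D.map (algebraMap (v.adicCompletionIntegers ℚ) (v.adicCompletion ℚ))).toX
      (algebraMap ℚ (v.adicCompletion ℚ) x) = algebraMap (v.adicCompletionIntegers ℚ) (v.adicCompletion ℚ) a := by
    rw [VariableChange.toX_def, hD]
    simp only [VariableChange.map, Units.map, map_one, inv_one, Units.val_one,
      one_pow, one_mul]
    change algebraMap ℚ (v.adicCompletion ℚ) x -
      algebraMap (v.adicCompletionIntegers ℚ) (v.adicCompletion ℚ) (r : v.adicCompletionIntegers ℚ) =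
        (a : v.adicCompletion ℚ)
    rw [hax, ← hx, map_sub, map_intCast, map_intCast]
  have hY : (D.map (algebraMap (v.adicCompletionIntegers ℚ) (v.adicCompletion ℚ))).toY
      (algebraMap ℚ (v.adicCompletion ℚ) x) (algebraMap ℚ (v.adicCompletion ℚ) y) =
      algebraMap (v.adicCompletionIntegers ℚ) (v.adicCompletion ℚ) b := by
    rw [VariableChange.toY_def, hD]
    simp only [VariableChange.map, Units.map, map_one, inv_one, Units.val_one,
      one_pow, one_mul, map_zero, zero_mul, sub_zero]
    change algebraMap ℚ (v.adicCompletion ℚ) y -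
      algebraMap (v.adicCompletionIntegers ℚ) (v.adicCompletion ℚ) (t : v.adicCompletionIntegers ℚ) =
        (b : v.adicCompletion ℚ)
    rw [hby, ← hy, map_sub, map_intCast, map_intCast]
  obtain ⟨h', e⟩ := LocalIndex.congrEquiv_pointEquiv_some (E₀.map (Int.castRingHom (v.adicCompletionIntegers ℚ))) D h
  rw [e]
  have h'' : ((D • E₀.map (Int.castRingHom (v.adicCompletionIntegers ℚ))).baseChange
      (v.adicCompletion ℚ)).toAffine.Nonsingular
      (algebraMap (v.adicCompletionIntegers ℚ) (v.adicCompletion ℚ) a)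
      (algebraMap (v.adicCompletionIntegers ℚ) (v.adicCompletion ℚ) b) := by
    rw [← hX, ← hY]; exact h'
  rw [show (Affine.Point.some _ _ h' :
      ((D • E₀.map (Int.castRingHom (v.adicCompletionIntegers ℚ))).baseChange (v.adicCompletion ℚ)).toAffine.Point) =
      .some _ _ h'' from point_some_congr hX hY]
  refine LocalIndex.not_hasNonsingularReduction_some _ ?_ ?_ ha hb h''
  · rw [hD3]; exact intCast_mem_maximalIdeal v h3
  · rw [hD4]; exact intCast_mem_maximalIdeal v h4

end Summit.BirchSwinnertonDyer.Rank1Residual.X10.ResidualSelmerLocalRamificationRat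

end


/-!
## §B — THE RECORD `118810j1` (theorems only, no definition, ONE named-fact hypothesis
## `poitouTate_selmerStructure_duality ℚ`; census `#Sel₃ = 3`; nothing booked)

`E′ = 118810j1 = [1, 1, 0, 843, −9811]` (`I₉` non-split at `2`, `I₃` SPLIT at `5` with `c₅ = 3`, `III`
at `109`; analytic rank `1`, `#Sel₃(E′) = 3` by the lane's exact `3`-descent). The record
`ResidualSelmerParityRecords.generatorTest_e118810j1` (x10 GEN 32, part B) left the alternative
"`loc₅ c` ramified / unramified" DISPLAYED. Here it is DECIDED IN THE KERNEL for the Kummer class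
`c = κ(P)` of the rational point `P = (187/9, 3262/27)`: `P ≡ (3, 1) (mod 5)` is the NODE of
`E′ mod 5` (`x − 3 = 160/9`, `y − 1 = 3235/27`, `5 ∣ 160, 3235`, `5 ∤ 9, 27`; the translate by
`(r, t) = (3, 1)` has `a₃' = 5`, `a₄' = 875`), so by PARTS X–XII (`localKummerMap_mem_unramifiedSubgroup_iff_hasNonsingularReduction_int`,
`not_hasNonsingularReduction_of_reduces_to_node`; split `I₃` at `5` with `ord₅ Δ = 3 = p`) the local
class `κ₅(P) = loc₅ κ(P)` (`KummerIndex.res_kummerMapTorsion_eq_localKummerMap`) is RAMIFIED; in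
particular `κ(P) ≠ 0`. Hence **`residualSelmerGroup_eq_bot_e118810j1` : `S⁰(118810j1) = ⊥`**,
conditional on the Poitou–Tate fact and the census `#Sel₃(E′) = 3` only. THE N2 READING: with a
kernel congruence `θ : 118810j1[3] ⥲ 118810q1[3]` (KO-certified today; a Hesse certificate would make
it kernel) `X10/ResidualSelmerCompanions.residualSelmerGroup_eq_bot_iff_of_congr` gives
`S⁰(118810q1) = 0` for the 180th N2 cell — the memo's "decided POSITIVELY" row. Nothing booked.

References: [MazurRubin2007] Prop. 1.3 (i), Thm. 1.4; [SilvermanAEC2009] VII.1.3(b), VII.2, X.§4;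
HOME/class-closure/N2/TRIVIAL-ROADS-x10g27.md §3; HOME/X10-AUDIT.md §38.5d.
-/

set_option autoImplicit false

noncomputable section

open scoped Classical NNReal

open Function NumberField IsDedekindDomain Field WeierstrassCurve IsLocalRing
  Literature.NumberTheory.EllipticCurves Literature.NumberTheory.GaloisRepresentations
  Literature.NumberTheory.GaloisCohomology IsDedekindDomain.HeightOneSpectrum Rat.HeightOneSpectrum
open Literature.NumberTheory.GaloisRepresentations.DiscreteGaloisModule (unramifiedSubgroup)
open Summit.BirchSwinnertonDyer.BirchSwinnertonDyer.Rank2Observatory.Tam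
open Summit.BirchSwinnertonDyer.Rank1Residual.Additive
open Summit.BirchSwinnertonDyer.Rank1Residual.X10.ResidualSelmerGroup
open Summit.BirchSwinnertonDyer.Rank1Residual.X10.ResidualSelmerParityRat
open Summit.BirchSwinnertonDyer.Rank1Residual.X10.ResidualSelmerParityRecords
open Summit.BirchSwinnertonDyer.Rank1Residual.X10.ResidualSelmerLocalRamificationInt
open Summit.BirchSwinnertonDyer.Rank1Residual.X10.ResidualSelmerLocalRamificationRat
open Summit.BirchSwinnertonDyer.Rank1Residual.X11b

namespace Summit.BirchSwinnertonDyer.Rank1Residual.X10.ResidualSelmerGeneratorTestRecord118810j1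

/-- An integer equation read in `ℤ_v` and then in `ℚ_v` is the equation read in `ℚ` and then in
`ℚ_v`. [folklore] -/
theorem baseChange_map_int_adicCompletion (E₀ : WeierstrassCurve ℤ) (v : HeightOneSpectrum (𝓞 ℚ)) :
    (E₀.map (Int.castRingHom (v.adicCompletionIntegers ℚ))).baseChange (v.adicCompletion ℚ) =
      (E₀.baseChange ℚ).baseChange (v.adicCompletion ℚ) := by
  ext <;> simp [baseChange, WeierstrassCurve.map]

/-- **`κ₅(P)` is RAMIFIED for `P = (187/9, 3262/27) ∈ 118810j1(ℚ)`** (the local Kummer class at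
the split `I₃` place `5` of a point reducing to the node), all `E`-side data in the kernel; no named
fact. Stated at a place `v` with `p_v = 5`. [cite: SilvermanAEC2009, VII.1 Prop. 1.3(b) and X.§4 diagram (**)]
[cite: MazurRubin2007, proof of Thm. 1.4] -/
theorem localKummerMap_not_mem_unramified_e118810j1
    (W : WeierstrassCurve ℚ) [W.IsElliptic] [hGM : W.IsGloballyMinimal]
    (hI : integralModelInt W = ⟨1, 1, 0, 843, -9811⟩)
    (hP : W.toAffine.Nonsingular (187 / 9 : ℚ) (3262 / 27))
    (v : HeightOneSpectrum (𝓞 ℚ)) (hv : natGenerator v = 5) (hp0 : ((3 : ℕ) : ℤ) ≠ 0) :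
    W.localKummerMap (v.adicCompletion ℚ) hp0
        (Affine.Point.baseChange (W' := W) ℚ (v.adicCompletion ℚ) (.some _ _ hP)) ∉
      unramifiedSubgroup ((W.torsionGaloisModule ((3 : ℕ) : ℤ)).restrictField (v.adicCompletion ℚ)) 1 := by
  -- the curve IS the integer model `[1, 1, 0, 843, -9811]` read in `ℚ`
  have hW : W = (⟨1, 1, 0, 843, -9811⟩ : WeierstrassCurve ℤ).baseChange ℚ :=
    IntModelTam.eq_baseChange_of_integralModelInt hI
  subst hW
  -- the place: `3 ≠ 5`, split `I₃`, `ord₅ Δ_min = 3`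
  have hpv : ((3 : ℕ) : 𝓞 ℚ) ∉ v.asIdeal := fun h => by
    have h' := (natCast_mem_asIdeal_iff_natGenerator_eq Nat.prime_three v).mp h
    rw [hv] at h'
    exact absurd h' (by decide)
  have hcheck : TamLocal.check ⟨5, 2, 1, 0, 0, 0, 0, 3, 0, 0, 3⟩
      (⟨1, 1, 0, 843, -9811⟩ : WeierstrassCurve ℤ) = true := by
    decide +kernel
  have hsplit : ((⟨1, 1, 0, 843, -9811⟩ : WeierstrassCurve ℤ).baseChange ℚ).HasSplitMultiplicativeReductionAt v :=
    hasSplitMultiplicativeReductionAt_of_check hcheck rfl v hv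
  have hn : ((⟨1, 1, 0, 843, -9811⟩ : WeierstrassCurve ℤ).baseChange ℚ).ordMinimalDiscriminant v = 3 :=
    ordMinimalDiscriminant_int_eq hv (hGM.isMinimal v) (by decide +kernel) (by decide +kernel)
  have hX := baseChange_map_int_adicCompletion ⟨1, 1, 0, 843, -9811⟩ v
  rw [localKummerMap_mem_unramifiedSubgroup_iff_hasNonsingularReduction_int _ v hpv hsplit hn hp0 hX]
  -- the base-changed point, read on the integer model
  have h' : ((((⟨1, 1, 0, 843, -9811⟩ : WeierstrassCurve ℤ).map
        (Int.castRingHom (v.adicCompletionIntegers ℚ))).baseChange (v.adicCompletion ℚ))).toAffine.Nonsingular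
      (algebraMap ℚ (v.adicCompletion ℚ) (187 / 9 : ℚ)) (algebraMap ℚ (v.adicCompletion ℚ) (3262 / 27 : ℚ)) := by
    rw [hX]
    exact (Affine.map_nonsingular (W := ((⟨1, 1, 0, 843, -9811⟩ : WeierstrassCurve ℤ).baseChange ℚ))
      (algebraMap ℚ (v.adicCompletion ℚ)).injective _ _).mpr hP
  have hbc : Affine.Point.congrEquiv hX.symm (Affine.Point.baseChange
      (W' := ((⟨1, 1, 0, 843, -9811⟩ : WeierstrassCurve ℤ).baseChange ℚ)) ℚ (v.adicCompletion ℚ)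
        (.some _ _ hP)) = .some _ _ h' := by
    rw [Affine.Point.baseChange, Affine.Point.map_some, Affine.Point.congrEquiv_some]
    exact point_some_congr (Algebra.ofId_apply _ _) (Algebra.ofId_apply _ _)
  rw [hbc]
  -- the point reduces to the node `(3, 1)`: translate `(r, t) = (3, 1)`, `x − 3 = 160/9`, `y − 1 = 3235/27`
  exact not_hasNonsingularReduction_of_reduces_to_node v ⟨1, 1, 0, 843, -9811⟩ 3 1
    (by rw [hv]; decide +kernel) (by rw [hv]; decide +kernel) (m := 160) (n := 9) (m' := 3235) (n' := 27)
    (by rw [hv]; decide +kernel) (by rw [hv]; decide +kernel) (by rw [hv]; decide +kernel)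
    (by rw [hv]; decide +kernel) (by norm_num) (by norm_num) h'

/-- Localisation at a finite place `v` IS restriction to the completion `K_v` (the place
completion `Place.Completion (inr v)` unfolds to `v.adicCompletion K`); membership in the unramified
subgroup transfers verbatim. [folklore] -/
theorem localization_inr_mem_unramifiedSubgroup_iff {K : Type} [Field K] [NumberField K]
    (W : WeierstrassCurve K) (n : ℤ) (v : HeightOneSpectrum (𝓞 K)) (c : galH1Torsion W n) :
    galoisCohomology.localization (W.torsionGaloisModule n) (Sum.inr v) 1 c ∈
        unramifiedSubgroup (GaloisRep.toLocal v (W.torsionGaloisModule n)) 1 ↔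
      galoisCohomology.res (W.torsionGaloisModule n) (v.adicCompletion K) 1 c ∈
        unramifiedSubgroup ((W.torsionGaloisModule n).restrictField (v.adicCompletion K)) 1 :=
  Iff.rfl

/-- The rational point `P = (187/9, 3262/27)` (a generator modulo torsion, Cremona's table) lies
on `118810j1 = [1, 1, 0, 843, −9811]`. [cite: Cremona2006, Table 1 (Cremona label 118810j1)] -/
theorem nonsingular_point_e118810j1 :
    ((⟨1, 1, 0, 843, -9811⟩ : WeierstrassCurve ℤ).baseChange ℚ).toAffine.Nonsingular
      (187 / 9 : ℚ) (3262 / 27) := by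
  rw [Affine.nonsingular_iff, Affine.equation_iff]
  simp only [baseChange, map_a₁, map_a₂, map_a₃, map_a₄, map_a₆]
  norm_num

/-- **`S⁰(118810j1) = ⊥` — the generator test (G) DECIDED IN THE KERNEL.** For the globally minimal
`118810j1` with census `#Sel₃ = 3`: the Kummer class of `P = (187/9, 3262/27)` is a non-zero Selmer class
RAMIFIED at `5` (`localKummerMap_not_mem_unramified_e118810j1` + the global-to-local square
`KummerIndex.res_kummerMapTorsion_eq_localKummerMap`), so the first alternative of
`ResidualSelmerParityRecords.generatorTest_e118810j1` applies. CONDITIONAL on the Poitou–Tate fact;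
census `hs`; nothing else (the point is checked ON the curve by `norm_num`); per cell; nothing booked.
[cite: MazurRubin2007, Prop. 1.3 (i) and Thm. 1.4] [cite: Cremona2006, Table 1 (Cremona label 118810j1)] -/
theorem residualSelmerGroup_eq_bot_e118810j1 (hfact : poitouTate_selmerStructure_duality ℚ)
    (W : WeierstrassCurve ℚ) [W.IsElliptic] [W.IsGloballyMinimal]
    (hI : integralModelInt W = ⟨1, 1, 0, 843, -9811⟩)
    (hs : Nat.card (W.selmerGroup (3 : ℤ)) = 3) : residualSelmerGroup W 3 = ⊥ := by
  -- the point `P = (187/9, 3262/27)` lies on the curve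
  have hP : W.toAffine.Nonsingular (187 / 9 : ℚ) (3262 / 27) := by
    rw [IntModelTam.eq_baseChange_of_integralModelInt hI]; exact nonsingular_point_e118810j1
  have hp0 : ((3 : ℕ) : ℤ) ≠ 0 := by norm_num
  have hdiv : ∀ P : geomPoints W, ∃ Q : geomPoints W, ((3 : ℕ) : ℤ) • Q = P :=
    W.zsmul_geomPoints_surjective_holds (by norm_num)
  -- the local certificate at the place `5`
  have hloc := localKummerMap_not_mem_unramified_e118810j1 W hI hP (pl 5)
    (natGenerator_pl (by norm_num)) hp0
  -- global-to-local square: `res₅ (κ P) = κ₅ (P)`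
  have key := KummerIndex.res_kummerMapTorsion_eq_localKummerMap W ((pl 5).adicCompletion ℚ) hp0 hdiv
    (.some _ _ hP)
  have hloc' : galoisCohomology.res (W.torsionGaloisModule ((3 : ℕ) : ℤ)) ((pl 5).adicCompletion ℚ) 1
        (kummerMapTorsion W ((3 : ℕ) : ℤ) hdiv (.some _ _ hP)) ∉
      unramifiedSubgroup ((W.torsionGaloisModule ((3 : ℕ) : ℤ)).restrictField
        ((pl 5).adicCompletion ℚ)) 1 := by
    intro h
    rw [key] at h
    exact hloc h
  -- `res` at `ℚ₅` IS `loc` at the place `5` (definitionally)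
  have hram : galoisCohomology.localization (W.torsionGaloisModule ((3 : ℕ) : ℤ)) (Sum.inr (pl 5)) 1
        (kummerMapTorsion W ((3 : ℕ) : ℤ) hdiv (.some _ _ hP)) ∉
      unramifiedSubgroup (GaloisRep.toLocal (pl 5) (W.torsionGaloisModule ((3 : ℕ) : ℤ))) 1 :=
    fun h => hloc' ((localization_inr_mem_unramifiedSubgroup_iff W ((3 : ℕ) : ℤ) (pl 5) _).mp h)
  have hc : kummerMapTorsion W ((3 : ℕ) : ℤ) hdiv (.some _ _ hP) ∈ W.selmerGroup ((3 : ℕ) : ℤ) :=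
    kummerMapTorsion_mem_selmerGroup W _ hdiv _
  have hc0 : kummerMapTorsion W ((3 : ℕ) : ℤ) hdiv (.some _ _ hP) ≠ 0 := fun h0 => hloc' (by
    have hz : galoisCohomology.res (W.torsionGaloisModule ((3 : ℕ) : ℤ)) ((pl 5).adicCompletion ℚ) 1
        (kummerMapTorsion W ((3 : ℕ) : ℤ) hdiv (.some _ _ hP)) = 0 := by
      rw [h0]; exact (galoisCohomology.res _ _ 1).map_zero
    rw [hz]; exact zero_mem _)
  exact (generatorTest_e118810j1 hfact W hI hs hc hc0).1 hram

end Summit.BirchSwinnertonDyer.Rank1Residual.X10.ResidualSelmerGeneratorTestRecord118810j1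

end
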